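import Literature.NumberTheory.Transcendental.PkappaThetaChartIdentities
import Literature.NumberTheory.Transcendental.PhilipponZeroEstimateStd
import HarnessLib

/-!
# The chart relations of the theta embedding of `M_κ` as homogeneous polynomials

Topic `Literature/NumberTheory/Transcendental`. A brick for the theta-model instance of the
abstract zero estimate (`ZeroEstModel.lean`, fields `surj`, `locRel`): for a chart
`M_c : γ → Fin 3` the following forms in `ℂ[X_J]`, `J ∈ Option β × ThetaIdx γ δ`, vanish on
`Θ(Lie M_κ)` (`thetaEval … = 0` at every point):

* `relT M_c j I = X_{(j,I)} X_{(∅,(M_c,∅))} - X_{(j,(M_c,∅))} X_{(∅,I)}` (torus/Segre, degree 2);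
* `relProd M_c M = X_{(∅,(M,∅))} X_{(∅,(M_c,∅))}^{|γ|-1} - ∏_b X_{(∅,(M_c[b↦M b],∅))}` (degree `|γ|`);
* `relCubic M_c b` — the Weierstrass cubic in `X_{(∅,(M_c[b↦i],∅))}`, `i = 0,1,2` (degree 3);
* `relFib M_c M e = X_{(∅,(M,e))} X_{(∅,(M_c,∅))} - X_{(∅,(M_c,e))} X_{(∅,(M,∅))}
   + ∑_b κ_{eb} zp_{M b, M_c b}(X_{(∅,(M[b↦·],∅))}, X_{(∅,(M_c[b↦·],∅))})` (degree 2),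

from the chart identities of `PkappaThetaChartIdentities.lean`. Everything is PROVED.

## References

* Yu. V. Nesterenko, P. Philippon (eds.), *Introduction to Algebraic Independence Theory*,
  LNM 1752, Springer 2001, Ch. 11 §2.1. [NesterenkoPhilippon2001]
-/

noncomputable section

open MvPolynomial

namespace Literature.NumberTheory.Transcendental

namespace GaGmE

namespace Std

variable {β γ δ : Type} [Fintype β] [Fintype γ] [Fintype δ] [DecidableEq γ]
variable (L : PeriodPair) (κM : δ → γ → Kbar) (Mc : γ → Fin 3)

/-! ### Evaluation of coordinates -/

omit [Fintype β] [Fintype δ] in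
/-- `Θ_{(none,(M,none))} = Θ^P_{(M,none)}`. [folklore] -/
@[simp] theorem theta_none_none (M : γ → Fin 3) (w : β ⊕ (γ ⊕ δ) → ℂ) :
    theta L κM (none, (M, none)) w = thetaPnone (δ := δ) L M w := by
  simp [theta]

omit [Fintype β] [Fintype δ] in
/-- `Θ_{(none,(M,some e))} = Θ^P_{(M,some e)}`. [folklore] -/
@[simp] theorem theta_none_some (M : γ → Fin 3) (e : δ) (w : β ⊕ (γ ⊕ δ) → ℂ) :
    theta L κM (none, (M, some e)) w = thetaPsome L κM M e w := by
  simp [theta]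

omit [Fintype β] [Fintype δ] in
/-- `Θ_{(some j, I)} = e^{y'_j} Θ_{(none, I)}`. [folklore] -/
theorem theta_some (j : β) (I : ThetaIdx γ δ) (w : β ⊕ (γ ⊕ δ) → ℂ) :
    theta L κM (some j, I) w = Complex.exp (w (iy j)) * theta L κM (none, I) w := by
  simp [theta]

/-! ### The torus relations -/

/-- `relT j I = X_{(j,I)} X_{(∅,(M_c,∅))} - X_{(j,(M_c,∅))} X_{(∅,I)}`. [folklore] -/
def relT (j : β) (I : ThetaIdx γ δ) : MvPolynomial (Option β × ThetaIdx γ δ) ℂ :=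
  X (some j, I) * X (none, (Mc, none)) - X (some j, (Mc, none)) * X (none, I)

omit [Fintype β] [Fintype γ] [Fintype δ] [DecidableEq γ] in
/-- `relT` is a quadratic form. [folklore] -/
theorem relT_isHomogeneous (j : β) (I : ThetaIdx γ δ) : (relT (δ := δ) Mc j I).IsHomogeneous 2 :=
  ((isHomogeneous_X ℂ _).mul (isHomogeneous_X ℂ _)).sub ((isHomogeneous_X ℂ _).mul (isHomogeneous_X ℂ _))

omit [Fintype β] [Fintype δ] in
/-- `relT` vanishes on `Θ(Lie M_κ)`. [folklore] -/
theorem thetaEval_relT (j : β) (I : ThetaIdx γ δ) (w : β ⊕ (γ ⊕ δ) → ℂ) : thetaEval L κM (relT Mc j I) w = 0 := by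
  simp only [relT, thetaEval, map_sub, map_mul, eval_X, theta_some]
  ring

/-! ### The product relations -/

/-- `relProd M = X_{(∅,(M,∅))} X_{(∅,(M_c,∅))}^{|γ|-1} - ∏_b X_{(∅,(M_c[b↦M b],∅))}`. [folklore] -/
def relProd (M : γ → Fin 3) : MvPolynomial (Option β × ThetaIdx γ δ) ℂ :=
  X (none, (M, none)) * X (none, (Mc, none)) ^ (Fintype.card γ - 1) -
    ∏ b, X (none, (Function.update Mc b (M b), none))

omit [Fintype β] [Fintype δ] in
/-- `relProd` is a form of degree `|γ|` (`γ` non-empty). [folklore] -/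
theorem relProd_isHomogeneous [Nonempty γ] (M : γ → Fin 3) :
    (relProd (β := β) (δ := δ) Mc M).IsHomogeneous (Fintype.card γ) := by
  have hγ : 1 ≤ Fintype.card γ := Fintype.card_pos
  have h1 : (X (none, (M, none)) * X (none, (Mc, none)) ^ (Fintype.card γ - 1) :
      MvPolynomial (Option β × ThetaIdx γ δ) ℂ).IsHomogeneous (Fintype.card γ) := by
    have hX1 : (X (none, (M, none)) : MvPolynomial (Option β × ThetaIdx γ δ) ℂ).IsHomogeneous 1 := isHomogeneous_X ℂ _
    have hX2 : (X (none, (Mc, none)) : MvPolynomial (Option β × ThetaIdx γ δ) ℂ).IsHomogeneous 1 := isHomogeneous_X ℂ _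
    have := hX1.mul (hX2.pow (Fintype.card γ - 1))
    rwa [one_mul, show 1 + (Fintype.card γ - 1) = Fintype.card γ by omega] at this
  have h2 : (∏ b, X (none, (Function.update Mc b (M b), none)) :
      MvPolynomial (Option β × ThetaIdx γ δ) ℂ).IsHomogeneous (Fintype.card γ) := by
    have := IsHomogeneous.prod (Finset.univ : Finset γ)
      (fun b => (X (none, (Function.update Mc b (M b), none)) : MvPolynomial (Option β × ThetaIdx γ δ) ℂ))
      (fun _ => 1) fun b _ => isHomogeneous_X ℂ _
    simpa using this
  exact h1.sub h2

omit [Fintype β] [Fintype δ] in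
/-- `relProd` vanishes on `Θ(Lie M_κ)`. [folklore] -/
theorem thetaEval_relProd (M : γ → Fin 3) (w : β ⊕ (γ ⊕ δ) → ℂ) : thetaEval L κM (relProd (β := β) Mc M) w = 0 := by
  simp only [relProd, thetaEval, map_sub, map_mul, map_pow, map_prod, eval_X, theta_none_none]
  rw [← prod_prod_erase_eq_pow, thetaPnone_mul_prod_eq, sub_self]

/-! ### The block cubics -/

/-- `relCubic b`: the Weierstrass cubic in `U_i = X_{(∅,(M_c[b↦i],∅))}`:
`U₂² U₀ - 4 U₁³ + g₂ U₁ U₀² + g₃ U₀³`. [cite: WhittakerWatson1927, §20.22] -/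
def relCubic (b : γ) : MvPolynomial (Option β × ThetaIdx γ δ) ℂ :=
  X (none, (Function.update Mc b 2, none)) ^ 2 * X (none, (Function.update Mc b 0, none)) -
    C 4 * X (none, (Function.update Mc b 1, none)) ^ 3 +
    C L.g₂ * X (none, (Function.update Mc b 1, none)) * X (none, (Function.update Mc b 0, none)) ^ 2 +
    C L.g₃ * X (none, (Function.update Mc b 0, none)) ^ 3

omit [Fintype β] [Fintype γ] [Fintype δ] in
/-- `relCubic` is a cubic form. [folklore] -/
theorem relCubic_isHomogeneous (b : γ) : (relCubic (β := β) (δ := δ) L Mc b).IsHomogeneous 3 := by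
  unfold relCubic
  refine ((IsHomogeneous.sub ?_ ?_).add ?_).add ?_
  · simpa using ((isHomogeneous_X ℂ (none, (Function.update Mc b 2, none))).pow 2).mul
      (isHomogeneous_X ℂ (none, (Function.update Mc b 0, none)) : IsHomogeneous (_ : MvPolynomial (Option β × ThetaIdx γ δ) ℂ) 1)
  · simpa using (isHomogeneous_C (Option β × ThetaIdx γ δ) (4 : ℂ)).mul ((isHomogeneous_X ℂ (none, (Function.update Mc b 1, none)) :
      IsHomogeneous (_ : MvPolynomial (Option β × ThetaIdx γ δ) ℂ) 1).pow 3)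
  · simpa using ((isHomogeneous_C _ L.g₂).mul (isHomogeneous_X ℂ (none, (Function.update Mc b 1, none)) :
      IsHomogeneous (_ : MvPolynomial (Option β × ThetaIdx γ δ) ℂ) 1)).mul
      ((isHomogeneous_X ℂ (none, (Function.update Mc b 0, none)) : IsHomogeneous (_ : MvPolynomial (Option β × ThetaIdx γ δ) ℂ) 1).pow 2)
  · simpa using (isHomogeneous_C _ L.g₃).mul
      ((isHomogeneous_X ℂ (none, (Function.update Mc b 0, none)) : IsHomogeneous (_ : MvPolynomial (Option β × ThetaIdx γ δ) ℂ) 1).pow 3)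

omit [Fintype β] [Fintype δ] in
/-- `relCubic` vanishes on `Θ(Lie M_κ)`. [folklore] -/
theorem thetaEval_relCubic (b : γ) (w : β ⊕ (γ ⊕ δ) → ℂ) : thetaEval L κM (relCubic (β := β) L Mc b) w = 0 := by
  simp only [relCubic, thetaEval, map_add, map_sub, map_mul, map_pow, eval_X, eval_C, theta_none_none]
  have h := thetaPnone_cubic (δ := δ) L Mc b w
  linear_combination h

/-! ### The fibre relations -/

/-- The quadratic `zp_{ij}(U, V)` with `zp_{ij}(P ∏, P ∏') = (Z_i P_j - Z_j P_i) ∏ ∏'`. [folklore] -/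
def zpPoly {σ : Type*} (i j : Fin 3) (U V : Fin 3 → MvPolynomial σ ℂ) : MvPolynomial σ ℂ :=
  ![![0, 0, -(C 2) * (U 1 * V 1)],
    ![0, 0, -(C (1 / 2 : ℂ)) * (U 2 * V 2 + C L.g₂ * (U 0 * V 1) + C L.g₃ * (U 0 * V 0))],
    ![C 2 * (U 1 * V 1), C (1 / 2 : ℂ) * (U 2 * V 2 + C L.g₂ * (U 0 * V 1) + C L.g₃ * (U 0 * V 0)), 0]] i j

omit [Fintype β] [Fintype γ] [Fintype δ] [DecidableEq γ] in
/-- `zp_{ij}` of linear forms is a quadratic form. [folklore] -/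
theorem zpPoly_isHomogeneous {σ : Type*} (i j : Fin 3) {U V : Fin 3 → MvPolynomial σ ℂ}
    (hU : ∀ k, (U k).IsHomogeneous 1) (hV : ∀ k, (V k).IsHomogeneous 1) : (zpPoly L i j U V).IsHomogeneous 2 := by
  have hUV : ∀ k l, (U k * V l).IsHomogeneous 2 := fun k l => (hU k).mul (hV l)
  have hq : (U 2 * V 2 + C L.g₂ * (U 0 * V 1) + C L.g₃ * (U 0 * V 0)).IsHomogeneous 2 := by
    refine ((hUV 2 2).add ?_).add ?_
    · simpa using (isHomogeneous_C σ L.g₂).mul (hUV 0 1)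
    · simpa using (isHomogeneous_C σ L.g₃).mul (hUV 0 0)
  have h2 : (C 2 : MvPolynomial σ ℂ).IsHomogeneous 0 := isHomogeneous_C σ (2 : ℂ)
  unfold zpPoly
  fin_cases i <;> fin_cases j
  · exact isHomogeneous_zero σ ℂ 2
  · exact isHomogeneous_zero σ ℂ 2
  · simpa using (h2.neg).mul (hUV 1 1)
  · exact isHomogeneous_zero σ ℂ 2
  · exact isHomogeneous_zero σ ℂ 2
  · simpa using ((isHomogeneous_C σ (1 / 2 : ℂ)).neg).mul hq
  · simpa using h2.mul (hUV 1 1)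
  · simpa using (isHomogeneous_C σ (1 / 2 : ℂ)).mul hq
  · exact isHomogeneous_zero σ ℂ 2

omit [Fintype β] [Fintype δ] in
/-- **Evaluation of `zp`** on the chart monomials:
`zp_{ij}(X_{(∅,(M[b↦·],∅))}, X_{(∅,(M_c[b↦·],∅))})(Θ w) = (Z_iP_j - Z_jP_i)(z'_b) ∏_{b'≠b} P_{M b'} P_{M_c b'}`.
[folklore] -/
theorem thetaEval_zpPoly (M : γ → Fin 3) (b : γ) (i j : Fin 3) (w : β ⊕ (γ ⊕ δ) → ℂ) :
    thetaEval L κM (zpPoly L i j (fun k => X (none, (Function.update M b k, none)))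
        (fun l => X (none, (Function.update Mc b l, none)))) w =
      L.zpVal i j (w (iz b)) * ∏ b' ∈ Finset.univ.erase b, (L.univExtP (M b') (w (iz b')) * L.univExtP (Mc b') (w (iz b'))) := by
  rw [L.zpVal_eq, Finset.prod_mul_distrib]
  unfold zpPoly thetaEval
  fin_cases i <;> fin_cases j <;>
    simp only [map_mul, map_add, map_neg, map_zero, eval_C, eval_X, theta_none_none, thetaPnone_update, Fin.zero_eta, Fin.mk_one,
      Fin.reduceFinMk, Matrix.cons_val_zero, Matrix.cons_val_one, Matrix.cons_val, zero_mul] <;>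
    ring

/-- `relFib M e = X_{(∅,(M,e))} X_{(∅,(M_c,∅))} - X_{(∅,(M_c,e))} X_{(∅,(M,∅))}
  + ∑_b κ_{eb} zp_{Mb, M_c b}(X_{(∅,(M[b↦·],∅))}, X_{(∅,(M_c[b↦·],∅))})`. [folklore] -/
def relFib (M : γ → Fin 3) (e : δ) : MvPolynomial (Option β × ThetaIdx γ δ) ℂ :=
  X (none, (M, some e)) * X (none, (Mc, none)) - X (none, (Mc, some e)) * X (none, (M, none)) +
    ∑ b, C (κM e b : ℂ) * zpPoly L (M b) (Mc b) (fun k => X (none, (Function.update M b k, none)))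
      (fun l => X (none, (Function.update Mc b l, none)))

omit [Fintype β] [Fintype δ] in
/-- `relFib` is a quadratic form. [folklore] -/
theorem relFib_isHomogeneous (M : γ → Fin 3) (e : δ) : (relFib (β := β) L κM Mc M e).IsHomogeneous 2 := by
  unfold relFib
  refine (((isHomogeneous_X ℂ _).mul (isHomogeneous_X ℂ _)).sub ((isHomogeneous_X ℂ _).mul (isHomogeneous_X ℂ _))).add ?_
  refine IsHomogeneous.sum _ _ _ fun b _ => ?_
  simpa using (isHomogeneous_C _ (κM e b : ℂ)).mul
    (zpPoly_isHomogeneous L (M b) (Mc b) (fun k => isHomogeneous_X ℂ _) (fun l => isHomogeneous_X ℂ _))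

omit [Fintype β] [Fintype δ] in
/-- `relFib` vanishes on `Θ(Lie M_κ)`. [folklore] -/
theorem thetaEval_relFib (M : γ → Fin 3) (e : δ) (w : β ⊕ (γ ⊕ δ) → ℂ) :
    thetaEval L κM (relFib (β := β) L κM Mc M e) w = 0 := by
  have h := thetaPsome_mul_sub L κM M Mc e w
  have hsum : thetaEval L κM (∑ b, C (κM e b : ℂ) * zpPoly L (M b) (Mc b) (fun k => X (none, (Function.update M b k, none)))
      (fun l => X (none, (Function.update Mc b l, none)))) w =
      ∑ b, (κM e b : ℂ) * (L.zpVal (M b) (Mc b) (w (iz b)) *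
        ∏ b' ∈ Finset.univ.erase b, (L.univExtP (M b') (w (iz b')) * L.univExtP (Mc b') (w (iz b')))) := by
    unfold thetaEval
    rw [map_sum]
    refine Finset.sum_congr rfl fun b _ => ?_
    rw [map_mul, eval_C]
    congr 1
    exact thetaEval_zpPoly L κM Mc M b (M b) (Mc b) w
  unfold relFib
  rw [show thetaEval L κM (X (none, (M, some e)) * X (none, (Mc, none)) - X (none, (Mc, some e)) * X (none, (M, none)) +
      ∑ b, C (κM e b : ℂ) * zpPoly L (M b) (Mc b) (fun k => X (none, (Function.update M b k, none)))
        (fun l => X (none, (Function.update Mc b l, none)))) w =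
      thetaEval L κM (X (none, (M, some e)) * X (none, (Mc, none)) - X (none, (Mc, some e)) * X (none, (M, none))) w +
      thetaEval L κM (∑ b, C (κM e b : ℂ) * zpPoly L (M b) (Mc b) (fun k => X (none, (Function.update M b k, none)))
        (fun l => X (none, (Function.update Mc b l, none)))) w from by unfold thetaEval; rw [map_add]]
  rw [hsum]
  simp only [thetaEval, map_sub, map_mul, eval_X, theta_none_none, theta_none_some]
  rw [h]
  ring

end Std

end GaGmE

end Literature.NumberTheory.Transcendental
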